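import Summits.CriticalPhenomena.PercolationContinuityZ3.Theorems.Transplant.TwoAxisBandStride
import HarnessLib

/-!
# D″ node, LEVEL 0 supplement for OPTION C (DPRIME-SCOPE addendum N.8, side track): the two-unit parameter lemma for a SHIFTED band —
# `TwoAxis.exists_twoUnitL_shift`: for a monotone band `(f, g, τ, m)`, an offset `d`, `c ≥ 1`, `L ≥ 1`, `A ≥ 2·L·c` and a floor `n₀`, there are
# `e_x, e_y ≥ max n₀ m` with `c·(G(L·e_x + d) + d) ≤ A·e_y` and `c·(F⁻¹(L·e_y + d) + d) ≤ A·e_x` — the two-unit property of the SHIFTED widths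
# `G̃(ℓ) := G(ℓ + d) + d`, `F̃(ℓ) := F⁻¹(ℓ + d) + d` that dominate the bands of every frame type at planar offset `≤ d` from the reference type

builds on p205010 (kernel theorem, internal audit signed; external expert review pending) — nothing in this file uses p205010.
Lane `prim-bschramm`, seat `prim-bschramm-p3` (gen 7; D″ design owner); helper file (`--supports stmt-CriticalPhenomena-4575`).
Proof = `exists_twoUnitL` (p251271) with the offsets carried along; the only new point: in the case `e_y = q` one has `c·G̃ ≥ A·E ≥ 2Lc·E`,
so `G̃(L e_x) ≥ 2L·E > 2L + 4d` as soon as the floor is `≥ 2d + 2` — no extra hypothesis on the seed scale.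
[cite: KozmaNitzan2024, §4 Lemma 11 pp. 22–23, Theorem 6 Step III p. 30] [cite: GrimmettPercolation1999, §7.3 Lemma (7.52) p. 170]
-/

noncomputable section

namespace Summit.CriticalPhenomena.PercolationContinuityZ3.Theorems.Transplant

namespace TwoAxis

open MeasureTheory Literature.Probability.Percolation SimpleGraph
open scoped Classical

variable {f g : ℕ → ℕ → ℝ} {τ : ℝ} {m : ℕ}

/-- **THE TWO-UNIT PARAMETER LEMMA FOR SHIFTED WIDTHS.**  For every monotone band, offset `d`, separation ratio `c ≥ 1`, stride factor `L ≥ 1`,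
unit ratio `A ≥ 2·L·c` and floor `n₀` there are `e_x, e_y ≥ max(n₀, m)` with `c·(G(L e_x + d) + d) ≤ A·e_y` and `c·(F⁻¹(L e_y + d) + d) ≤ A·e_x`.
[cite: KozmaNitzan2024, §4 Lemma 11 pp. 22–23, Theorem 6 Step III p. 30] -/
theorem exists_twoUnitL_shift (hb : IsMonotoneBand f g τ m) (d : ℕ) {L : ℕ} (hL : 1 ≤ L) {c A : ℕ} (hc : 1 ≤ c)
    (hA : 2 * L * c ≤ A) (n₀ : ℕ) :
    ∃ ex ey : ℕ, n₀ ≤ ex ∧ n₀ ≤ ey ∧ m ≤ ex ∧ m ≤ ey ∧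
      c * (bandG g τ m (L * ex + d) + d) ≤ A * ey ∧ c * (bandFinv f τ m (L * ey + d) + d) ≤ A * ex := by
  have hLc : 1 ≤ 2 * L * c := by nlinarith
  have hA0 : 0 < A := by omega
  have hAc : 2 * c ≤ A := le_trans (by nlinarith) hA
  -- the floor `E ≥ max n₀ m (2d + 3)` and a width `ℓ⋆` with certified tops at height `L·E + d`
  set E : ℕ := max (max n₀ m) (2 * d + 3) with hE
  have hEm : m ≤ E := (le_max_right _ _).trans (le_max_left _ _)
  have hEn : n₀ ≤ E := (le_max_left _ _).trans (le_max_left _ _)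
  have hEd : 2 * d + 3 ≤ E := le_max_right _ _
  have hLE : m ≤ L * E + d := hEm.trans ((Nat.le_mul_of_pos_left E (by omega)).trans (Nat.le_add_right _ _))
  set ℓs : ℕ := bandFinv f τ m (L * E + d) with hℓs
  -- the x-step extent
  set ex : ℕ := max E ℓs with hex
  have hexE : E ≤ ex := le_max_left _ _
  have hexℓ : ℓs ≤ ex := le_max_right _ _
  have hexm : m ≤ ex := hEm.trans hexE
  have hLex : ex ≤ L * ex := Nat.le_mul_of_pos_left ex (by omega)
  have hmLex : m ≤ L * ex + d := hexm.trans (hLex.trans (Nat.le_add_right _ _))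
  -- the shifted spread of the longest x-step and the y-step extent
  set Gx : ℕ := bandG g τ m (L * ex + d) + d with hGx
  set q : ℕ := c * Gx / A + 1 with hq
  set ey : ℕ := max E q with hey
  have heyE : E ≤ ey := le_max_left _ _
  have heyq : q ≤ ey := le_max_right _ _
  refine ⟨ex, ey, hEn.trans hexE, hEn.trans heyE, hexm, hEm.trans heyE, ?_, ?_⟩
  · -- `c · G̃(L e_x) ≤ A · e_y`
    rw [← hGx]
    have h1 : c * Gx < A * q := lt_mul_div_add_one hA0 (c * Gx)
    have h2 : A * q ≤ A * ey := Nat.mul_le_mul_left A heyq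
    omega
  · -- `c · F̃(L e_y) ≤ A · e_x`
    rcases le_total q E with hqe | hqe
    · -- `ey = E`: `F⁻¹(L E + d) = ℓ⋆ ≤ e_x` by the choice of `e_x`
      have heq : ey = E := by rw [hey, max_eq_left hqe]
      rw [heq, ← hℓs]
      have hdex : d ≤ ex := le_trans (by omega) hexE
      calc c * (ℓs + d) ≤ c * (ex + d) := Nat.mul_le_mul_left c (by omega)
        _ = c * ex + c * d := by ring
        _ ≤ c * ex + c * ex := by have := Nat.mul_le_mul_left c hdex; omega
        _ = (2 * c) * ex := by ring
        _ ≤ A * ex := Nat.mul_le_mul_right ex hAc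
    · -- `ey = q`: `L q + d < G(L e_x + d)`, so the dichotomy certifies the tops of `R(L e_x + d, L q + d)`
      have heq : ey = q := by rw [hey, max_eq_right hqe]
      have hqm' : m ≤ q := hEm.trans hqe
      have hqm : m ≤ L * q + d := hqm'.trans ((Nat.le_mul_of_pos_left q (by omega)).trans (Nat.le_add_right _ _))
      -- `c·Gx/A ≤ Gx/(2L)` from `A ≥ 2Lc`
      set D : ℕ := Gx / (2 * L) with hD
      have hdiv : c * Gx / A ≤ D := by
        have h2 : 0 < 2 * L * c := by omega
        calc c * Gx / A ≤ c * Gx / (2 * L * c) := Nat.div_le_div_left hA h2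
          _ = c * Gx / (c * (2 * L)) := by rw [Nat.mul_comm (2 * L) c]
          _ = Gx / (2 * L) := Nat.mul_div_mul_left Gx (2 * L) (by omega)
      have hDle : D * (2 * L) ≤ Gx := Nat.div_mul_le_self Gx (2 * L)
      have hqD : q ≤ D + 1 := by rw [hq]; omega
      have hP : L * q ≤ L * (D + 1) := Nat.mul_le_mul_left L hqD
      -- in this case `c·Gx ≥ A·(E − 1) ≥ 2Lc·(E − 1)`, so `Gx ≥ 2L·(E − 1) > 2L + 4d`
      have hGE : (E - 1) * A ≤ c * Gx := by
        have h : E - 1 ≤ c * Gx / A := by rw [hq] at hqe; omega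
        exact (Nat.le_div_iff_mul_le hA0).1 h
      set Z : ℕ := L * (E - 1) with hZ
      have hGE' : 2 * Z ≤ Gx := by
        have h1 : c * (2 * Z) ≤ c * Gx := by
          calc c * (2 * Z) = (E - 1) * (2 * L * c) := by rw [hZ]; ring
            _ ≤ (E - 1) * A := Nat.mul_le_mul_left _ hA
            _ ≤ c * Gx := hGE
        exact Nat.le_of_mul_le_mul_left h1 (by omega)
      have hZ2 : 2 * d + 2 * L ≤ Z := by
        have h1 : L * (2 * d + 2) ≤ Z := Nat.mul_le_mul_left L (by omega)
        have h2 : d ≤ L * d := Nat.le_mul_of_pos_left d (by omega)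
        nlinarith
      have hX : 2 * (L * D) ≤ Gx := by
        calc 2 * (L * D) = D * (2 * L) := by ring
          _ ≤ Gx := hDle
      have hY : L * q ≤ L * D + L := by
        calc L * q ≤ L * (D + 1) := hP
          _ = L * D + L := by ring
      have hlt : L * q + d < bandG g τ m (L * ex + d) := by
        have hG : bandG g τ m (L * ex + d) = Gx - d := by rw [hGx]; omega
        rw [hG]
        omega
      have hcert : τ ≤ f (L * ex + d) (L * q + d) := f_cert_of_lt_bandG hb hmLex hqm hlt
      have hle : bandFinv f τ m (L * q + d) ≤ L * ex + d := bandFinv_le hmLex hcert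
      rw [heq]
      have hex2 : 2 * d ≤ ex := le_trans (by omega) hexE
      calc c * (bandFinv f τ m (L * q + d) + d) ≤ c * (L * ex + 2 * d) := Nat.mul_le_mul_left c (by omega)
        _ = c * (L * ex) + c * (2 * d) := by ring
        _ ≤ c * (L * ex) + c * ex := by have := Nat.mul_le_mul_left c hex2; omega
        _ ≤ c * (L * ex) + c * (L * ex) := by have := Nat.mul_le_mul_left c hLex; omega
        _ = (2 * L * c) * ex := by ring
        _ ≤ A * ex := Nat.mul_le_mul_right ex hA

end TwoAxis

end Summit.CriticalPhenomena.PercolationContinuityZ3.Theorems.Transplant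

end
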